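import Summits.HubbardSuperconductivity.HubbardSuperconductivity.Theorems.AnisotropyChordDressHalfFilledSecondOrderLower
import Literature.MathematicalPhysics.QuantumLattice.FreeFermiGasPairGramBounds
import HarnessLib

/-!
# Crux `DressHalfFilled` (stmt-HubbardSuperconductivity-8148, routes `AnisotropyChord` / `LevyLogBootstrap`), stub 3
# `stub_dressHalfFilled`: LOW-ENERGY STATES LIVE ON THE PLAQUETTE GROUND SPACE UP TO `O(t)` (abstract, gapped sector)

Helper file (`--supports stmt-HubbardSuperconductivity-8148`), continuing `…SecondOrderLower` / `…SecondOrderSandwich`. Same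
abstract setting (`H₀, T` Hermitian, `P = eigenProj H₀ E₀`, sector `K` stable under `P`, gap `g` of `H₀ − E₀` on `K ∩ ker P`, form
bound `τ` of `T`, no first-order term on `PK`).

* `neg_le_two_mul_of_sq_le` — the AM–GM step `2t|η| ≤ a + b` from `η² ≤ n·m`, `a = (g/2)n`, `b = (2t²/g)m`;
* `normSq_offGround_le` — **every unit `ψ ∈ K` with energy `Re⟨ψ, (H₀ + tT)ψ⟩ ≤ E₀ + D t²`** (in particular every sector ground
  state, by `…SecondOrderUpper`) **has `(g/4)·‖ψ − Pψ‖² ≤ t²·(D + 2m/g)`** whenever `4tτ ≤ g`, where `m ≥ Re⟨T Pψ, T Pψ⟩`: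
  the weight of a low-energy state outside the unperturbed (plaquette) ground space is `O(t²)` — at fixed volume (the constants
  `g, τ, m` degrade with `L`).

This is the first input of the fixed-`L` concentration argument (ground states of `H_in + t'T` ≈ dressed XXZ ground states); the
second is the near-optimality of `Pψ` (`…SecondOrderSandwich`) combined with the XXZ sector gap (`exists_gap_groundProj_form`).
HONEST LABEL: abstract finite-dimensional perturbation theory; nothing uniform in `L`; no order statement; the content of stub 3
is untouched; no crux and no summit statement is proved. Sources: T. Kato (1966) II-§2.3 [Kato1966]; Tasaki (2020) §2.1.
No definition and no named fact is introduced; sorry-free.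
-/

noncomputable section

-- `dupNamespace`: the summit and the problem are both named `HubbardSuperconductivity` (layout D-0022)
set_option linter.dupNamespace false

namespace Summit.HubbardSuperconductivity.HubbardSuperconductivity.Theorems.AnisotropyChord.DressSecond

open Matrix Literature.MathematicalPhysics.QuantumLattice
open scoped ComplexOrder

/-- AM–GM step: from `η² ≤ n·m` (`n, m ≥ 0`), `g > 0`: `−((g/2)·n + (2t²/g)·m) ≤ 2tη`. [folklore] -/
theorem neg_le_two_mul_of_sq_le {η n m g t : ℝ} (hη : η ^ 2 ≤ n * m) (hn : 0 ≤ n) (hm : 0 ≤ m) (hg : 0 < g) :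
    -((g / 2) * n + (2 * t ^ 2 / g) * m) ≤ 2 * t * η := by
  set a : ℝ := (g / 2) * n with ha
  set b : ℝ := (2 * t ^ 2 / g) * m with hb
  have ha0 : 0 ≤ a := by positivity
  have hb0 : 0 ≤ b := by positivity
  have hab : a * b = t ^ 2 * (n * m) := by rw [ha, hb]; field_simp
  have hsq : (2 * t * η) ^ 2 ≤ (a + b) ^ 2 := by
    have h1 : (2 * t * η) ^ 2 = 4 * t ^ 2 * η ^ 2 := by ring
    have h2 : 4 * t ^ 2 * η ^ 2 ≤ 4 * (a * b) := by rw [hab]; nlinarith [sq_nonneg t]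
    nlinarith [sq_nonneg (a - b)]
  exact (abs_le_of_sq_le_sq' hsq (add_nonneg ha0 hb0)).1

variable {m : Type*} [Fintype m] [DecidableEq m]

/-- **Low-energy states concentrate on the unperturbed ground space.** `H₀, T` Hermitian, `P = eigenProj H₀ E₀`; `K` a subspace
with `P K ⊆ K`; gap: `g‖v‖² ≤ Re⟨v,(H₀ − E₀)v⟩` for `v ∈ K ∩ ker P`; form bound `|Re⟨v,Tv⟩| ≤ τ‖v‖²` on `K`; no first-order term
`Re⟨Pv, T Pv⟩ = 0` on `K`. If a unit `ψ ∈ K` has `Re⟨ψ, (H₀ + tT)ψ⟩ ≤ E₀ + D t²`, `0 ≤ t`, `4tτ ≤ g`, and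
`Re⟨T Pψ, T Pψ⟩ ≤ mT`, then `(g/4)·‖ψ − Pψ‖² ≤ t²·(D + 2·mT/g)`. (Expand `ψ = Pψ + q`: the energy excess is
`𝒜(q) + 2t Re⟨q, T Pψ⟩ + t Re⟨q, Tq⟩ ≥ g‖q‖² − (g/2)‖q‖² − (2t²/g)mT − (g/4)‖q‖²`.) Kato (1966) II-§2.3. [folklore] -/
theorem normSq_offGround_le {H₀ T : Matrix m m ℂ} (hH₀ : H₀.IsHermitian) (hT : T.IsHermitian)
    (K : Submodule ℂ (m → ℂ)) {E₀ g τ D mT t : ℝ}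
    (hKP : ∀ v ∈ K, eigenProj H₀ E₀ *ᵥ v ∈ K) (hg : 0 < g)
    (hgap : ∀ v ∈ K, eigenProj H₀ E₀ *ᵥ v = 0 →
      g * (star v ⬝ᵥ v).re ≤ (star v ⬝ᵥ (H₀ *ᵥ v)).re - E₀ * (star v ⬝ᵥ v).re)
    (hτ : ∀ v ∈ K, |(star v ⬝ᵥ (T *ᵥ v)).re| ≤ τ * (star v ⬝ᵥ v).re)
    (hPTP : ∀ v ∈ K, (star (eigenProj H₀ E₀ *ᵥ v) ⬝ᵥ (T *ᵥ (eigenProj H₀ E₀ *ᵥ v))).re = 0)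
    (ht0 : 0 ≤ t) (htg : 4 * t * τ ≤ g)
    {ψ : m → ℂ} (hψ : ψ ∈ K) (hψ1 : star ψ ⬝ᵥ ψ = 1)
    (hR : (star ψ ⬝ᵥ ((H₀ + (t : ℂ) • T) *ᵥ ψ)).re ≤ E₀ + D * t ^ 2)
    (hmT : (star (T *ᵥ (eigenProj H₀ E₀ *ᵥ ψ)) ⬝ᵥ (T *ᵥ (eigenProj H₀ E₀ *ᵥ ψ))).re ≤ mT) :
    g / 4 * (star (ψ - eigenProj H₀ E₀ *ᵥ ψ) ⬝ᵥ (ψ - eigenProj H₀ E₀ *ᵥ ψ)).re ≤ t ^ 2 * (D + 2 * mT / g) := by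
  set P := eigenProj H₀ E₀ with hP
  have hPh : P.IsHermitian := eigenProj_isHermitian H₀ E₀
  have hτ0 : 0 ≤ τ := by
    have h := hτ ψ hψ
    rw [hψ1, Complex.one_re, mul_one] at h
    exact (abs_nonneg _).trans h
  set p := P *ᵥ ψ with hp
  set q := ψ - p with hq
  have hpK : p ∈ K := hKP ψ hψ
  have hqK : q ∈ K := K.sub_mem hψ hpK
  have hPq : P *ᵥ q = 0 := by
    rw [hq, mulVec_sub, hp, mulVec_mulVec, eigenProj_mul_eigenProj, sub_self]
  have hψpq : ψ = p + q := by rw [hq]; abel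
  have hHp : H₀ *ᵥ p = (E₀ : ℂ) • p := mulVec_eigenProj_mulVec hH₀ E₀ ψ
  have hpq : star p ⬝ᵥ q = 0 := by
    rw [hp, star_mulVec, ← dotProduct_mulVec, hPh.eq, hPq, dotProduct_zero]
  have hqp : star q ⬝ᵥ p = 0 := by rw [star_dotProduct, hpq, star_zero]
  have hpHq : star p ⬝ᵥ (H₀ *ᵥ q) = 0 := by
    rw [RayleighBottom.star_dotProduct_mulVec_eq, hH₀.eq, hHp, star_smul, smul_dotProduct, hpq, smul_zero]
  have hqHp : star q ⬝ᵥ (H₀ *ᵥ p) = 0 := by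
    rw [hHp, dotProduct_smul, hqp, smul_zero]
  have hqTp : (star q ⬝ᵥ (T *ᵥ p)).re = (star p ⬝ᵥ (T *ᵥ q)).re := by
    rw [RayleighBottom.star_dotProduct_mulVec_eq, hT.eq, star_dotProduct, Complex.star_def, Complex.conj_re]
  set np : ℝ := (star p ⬝ᵥ p).re with hnp
  set nq : ℝ := (star q ⬝ᵥ q).re with hnq
  have hnq0 : 0 ≤ nq := (Complex.nonneg_iff.mp (dotProduct_star_self_nonneg q)).1
  have hnorm : np + nq = 1 := by
    have h := congrArg Complex.re hψ1
    rw [hψpq, star_add, add_dotProduct, dotProduct_add, dotProduct_add, hpq, hqp, add_zero, zero_add,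
      Complex.add_re, Complex.one_re] at h
    rw [hnp, hnq]; exact h
  set A : ℝ := (star q ⬝ᵥ (H₀ *ᵥ q)).re - E₀ * nq with hA
  set η : ℝ := (star q ⬝ᵥ (T *ᵥ p)).re with hη
  set θ : ℝ := (star q ⬝ᵥ (T *ᵥ q)).re with hθ
  have hRe : (star ψ ⬝ᵥ ((H₀ + (t : ℂ) • T) *ᵥ ψ)).re = E₀ + A + 2 * t * η + t * θ := by
    have e : star ψ ⬝ᵥ ((H₀ + (t : ℂ) • T) *ᵥ ψ) =
        (E₀ : ℂ) * (star p ⬝ᵥ p) + star q ⬝ᵥ (H₀ *ᵥ q) +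
          (t : ℂ) * (star p ⬝ᵥ (T *ᵥ p) + star p ⬝ᵥ (T *ᵥ q) + star q ⬝ᵥ (T *ᵥ p) + star q ⬝ᵥ (T *ᵥ q)) := by
      rw [add_mulVec, smul_mulVec, dotProduct_add, dotProduct_smul, smul_eq_mul]
      conv_lhs => rw [hψpq]
      rw [star_add, mulVec_add, mulVec_add, add_dotProduct, dotProduct_add, dotProduct_add, add_dotProduct,
        dotProduct_add, dotProduct_add, hpHq, hqHp, hHp, dotProduct_smul, smul_eq_mul]
      ring
    rw [e]
    simp only [Complex.add_re, Complex.re_ofReal_mul]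
    rw [hPTP ψ hψ, ← hqTp, ← hnp, ← hη, ← hθ, hA]
    have : np = 1 - nq := by linarith
    rw [this]; ring
  rw [hRe] at hR
  -- the three estimates
  have hAq : g * nq ≤ A := by
    have h := hgap q hqK hPq
    rw [← hnq] at h; rw [hA]; linarith
  have hθq : -(τ * nq) ≤ θ := by
    have h := hτ q hqK
    rw [← hnq, ← hθ] at h
    exact neg_le_of_abs_le h
  have hmT0 : 0 ≤ mT := le_trans (Complex.nonneg_iff.mp (dotProduct_star_self_nonneg _)).1 hmT
  have hη2 : η ^ 2 ≤ nq * mT := by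
    have hcs := norm_star_dotProduct_sq_le q (T *ᵥ p)
    rw [← hnq] at hcs
    have h1 : η ^ 2 ≤ ‖star q ⬝ᵥ (T *ᵥ p)‖ ^ 2 := by
      rw [hη, sq_le_sq, abs_norm]
      exact Complex.abs_re_le_norm _
    have h2 : nq * (star (T *ᵥ p) ⬝ᵥ (T *ᵥ p)).re ≤ nq * mT := mul_le_mul_of_nonneg_left hmT hnq0
    linarith
  have hamgm := neg_le_two_mul_of_sq_le (t := t) hη2 hnq0 hmT0 hg
  -- assemble: `A + 2tη + tθ ≤ D t²`
  have htθ : -(g / 4 * nq) ≤ t * θ := by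
    have h1 : t * -(τ * nq) ≤ t * θ := mul_le_mul_of_nonneg_left hθq ht0
    have h2 : t * τ * nq ≤ g / 4 * nq := by
      have : t * τ ≤ g / 4 := by linarith
      exact mul_le_mul_of_nonneg_right this hnq0
    linarith
  have hmain : g * nq - (g / 2 * nq + 2 * t ^ 2 / g * mT) - g / 4 * nq ≤ D * t ^ 2 := by linarith
  have e : g * nq - (g / 2 * nq + 2 * t ^ 2 / g * mT) - g / 4 * nq = g / 4 * nq - t ^ 2 * (2 * mT / g) := by
    field_simp; ring
  rw [e] at hmain
  linarith

end Summit.HubbardSuperconductivity.HubbardSuperconductivity.Theorems.AnisotropyChord.DressSecond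

end
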